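import Literature.NumberTheory.GaloisCohomology.Howard2004.InertLocalPairingSymmetryProofs
import Literature.NumberTheory.GaloisCohomology.Howard2004.ConjugationDatumOfLifts
import Literature.NumberTheory.GaloisCohomology.Howard2004.DualityDatumTateDualBridge
import Literature.NumberTheory.EllipticCurves.SemilinearTateDualPlaces
import Literature.NumberTheory.EllipticCurves.SemilinearLocalCohomology
import Literature.NumberTheory.GaloisRepresentations.BrauerTower
import HarnessLib

/-!
# Howard 2004, Lemma 1.5.3: the `G_ℚ`-invariance of the local Tate pairing at the residual level, PROVED for the
# canonical conjugation datum `ConjugationDatum.ofLifts` from the functoriality of the invariant maps (theorems only)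

Topic `NumberTheory/GaloisCohomology/Howard2004`. THEOREMS ONLY: no definition, no named fact, no instance, no
notation, no `sorry`. Cell `pub/bsd-print-x9`, print leaf G87
`Literature.NumberTheory.GaloisCohomology.Howard2004.thm161_dvrKolyvaginBound`; seat `bsd-line-x10b-p1-w5` g8, third file of
(TAU-INV) after `InertLocalPairingSymmetryProofs` (P(s,t) = ē(s, θt), `∪_P`, swap rules) and
`InertLocalPairingInvarianceProofs` (hypothesis `hGQ` ⇒ `H¹(K_q, T̄)⁺ ⊥ H¹(K_q, T̄)⁻`). THIS FILE DISCHARGES `hGQ` for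
`cd := ConjugationDatum.ofLifts σ hσ₁ hσ τ hτ hτ₂` (the datum of the Eisenstein/Heegner settings,
`ZpExtensionEisensteinDVRSettingSatisfiesHOfLiftsProofs`).

SOURCE. B. Howard, Compositio Math. **140** (2004) = arXiv:1202.6340, Lemma 1.5.3 (p. 10 L10–12: «exact orthogonal
complements under the `G_ℚ`-invariant local Tate pairing»), §1.3 and Rem. 1.3.2 (p. 7 L44–48, p. 8 L13–17: «the
composition `H¹(K_v̄, T) → H¹(K_v, Tw(T)) → H¹(K_v, T)` is the usual action of complex conjugation. Using this
identification the local pairing of H.4 is exactly the usual local Tate pairing»). The `G_ℚ`-invariance of the local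
Tate pairing at an inert prime is: conjugation by (a lift of) `σ` transports cup products, and THE invariant maps are
compatible with the transport of completions (Serre, *Local class field theory*, Cassels–Fröhlich Ch. VI §1.1,
functoriality of `inv` — the tree's `LocalInvariants.IsConjCompatible σ`, fifth conjunct of
`poitouTate_selmerStructure_duality_conj`, a kernel theorem for the canonical family: `isConjCompatible_canonical`).

WHAT IS PROVED (for `cd = ofLifts σ hσ₁ hσ τ hτ hτ₂`, `Dbar : DualityDatum p cd ρbar R`, `A : ResidualTau cd ρbar`):
* §1 `ConjugationDatum.ofLifts_δ_eq_divGal` (`δ_v = τ⁻¹ τ_v`, rfl), `tauAt_apply_eq` (`τ_v x = τ (δ_v x)`),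
  `conjGalCMH_tauAt` (`τ_v⁻¹ g τ_v = δ_v⁻¹ (τ⁻¹ g τ) δ_v`), `muSemilinearMap_tauAt` (on `μ_N`: `τ_v ζ = −δ_v ζ` when
  `τ` inverts `μ_N`).
* §2 `ResidualTau.isSemilinear_theta_delta` (`Θ_v := θ ∘ ρ̄(δ_v)` is `τ_v`-semilinear) and
  **`thetaH1_transportH1_ofLifts_eq_semilinearLocalH`**: Howard's `θ_* ∘ transport_v` IS the tree's semilinear local
  action `semilinearLocalH` (Cassels–Fröhlich VII §1.1 `σ_*`) along the adapted pair of `ofLifts` with coefficient map `Θ_v`.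
* §3 the `μ`-valued pairing `exp λ ē(·, θ ·)` (`(Dbar.muPairing lam exp).compl₂ A.θ`): `Γ_K`-equivariance
  (`muPairing_compl₂_theta_equivariant`) and `τ_v`-compatibility **`muPairing_compl₂_theta_semilinear`**
  (`exp λ ē(Θ_v s, θ Θ_v t) = τ_v · exp λ ē(s, θ t)`, from H.5(c) `hθ`, H.4 at `δ_v`, and `hτμ` «`τ` inverts `μ_{p^k}`»).
* §4 `cohomologyMap_expLam_cupProduct_thetaPairing` (`H²(exp λ)(a ∪_P b) = a ∪_{exp λ P} b`),
  `muConjPlace_eq_semilinearLocalH_tauAt` (the `H²`-transport on `μ_{p^k}` IS `muConjPlace σ (p^k) _ 2`, rfl), and the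
  headline **`inv_cohomologyMap_cupProduct_thetaH1_transportH1_ofLifts`**: for every finite `v` (with `hv : σ•(σ•v) = v`)
  and `x, y ∈ H¹(K_{σ v}, T̄)`,
  `inv_v (H²(exp λ)(τ_v x ∪_P τ_v y)) = inv_{σ v} (H²(exp λ)(x ∪_P y))` — EXACTLY the hypothesis `hGQ` of
  `InertLocalPairingInvarianceProofs` for `ι_w := inv_w ∘ H²(exp λ)` (at an inert `q` take `v := q`).

LETTERS KEPT (all dischargeable in the Eisenstein settings): `hθ : ē(θx, θy) = −ē(x,y)` (H.5(c), delivered with the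
residual datum by `DVRSetting.exists_residualDualityDatum`), `hτμ : muSemilinearMap τ (p^k) ζ = −ζ` (`τ` a complex
conjugation inverts roots of unity, cf. `HeegnerPointsKolyvaginConjugation` «`c₀ ζ = ζ⁻¹`»), the reading `(λ, hlam, exp, hexp)`
of `DualityDatumTateDualBridge`, `inv` with `IsConjCompatible σ`.

TYPING NOTE. `cd.σ • v` (with `cd = ofLifts …`) and `σ • v`, `Place.Completion (Sum.inr w)` and `w.adicCompletion K`,
`galoisCohomology` and `continuousCohomology` are definitionally but not reducibly equal: statements use Howard's
spellings, proofs bridge with `exact`/`change`/`Eq.trans` (never `rw` across spellings) and cocycle identities.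

NOT HERE: eigenlines, Poitou–Tate, the `SelmerStructure` bookkeeping, `χ(τ) = −1` as a theorem about an abstract
involution (kept as `hτμ`); `thm161_dvrKolyvaginBound` is NOT proved; no summit statement is proved; the
Birch–Swinnerton-Dyer conjecture is not proved by any of this.
References: [Howard2004HeegnerKolyvagin] §1.3, Rem. 1.3.2, Lemma 1.5.3; [CasselsFrohlichANT1967] Ch. VI §1.1,
Ch. VII §1.1; [SerreGaloisCohomology1997] I §2.4, II §1.1; [NeukirchSchmidtWingberg2008] I §4 (1.4.2), I §5;
[MilneADT2006] I §0, Cor. 2.3.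
-/

set_option autoImplicit false

noncomputable section

open Function NumberField IsDedekindDomain Field CategoryTheory
open scoped NumberField

namespace Literature.NumberTheory.GaloisCohomology.Howard2004

open Literature.NumberTheory.GaloisRepresentations
open Literature.NumberTheory.GaloisRepresentations.DiscreteGaloisModule
open Literature.NumberTheory.EllipticCurves

variable {K : Type} [Field K] [NumberField K] {Nbar : Type} [AddCommGroup Nbar]
  [TopologicalSpace Nbar] [DiscreteTopology Nbar] {R : Type} [CommRing R] [TopologicalSpace R]
  [DiscreteTopology R] [Module R Nbar] {p : ℕ} [Fact p.Prime] [Algebra ℤ_[p] R]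
  {σ : K ≃ₐ[ℚ] K} {hσ₁ : σ ≠ 1} {hσ : σ * σ = 1} {τ : AlgebraicClosure K ≃+* AlgebraicClosure K}
  {hτ : IsLiftOfAut σ τ} {hτ₂ : Function.Involutive τ} {ρbar : DiscreteGaloisModule K Nbar}

namespace ConjugationDatum

/-! ## §1 The canonical datum: `δ_v = τ⁻¹ τ_v`, `τ_v x = τ (δ_v x)`, `τ_v⁻¹ g τ_v = δ_v⁻¹ (τ⁻¹ g τ) δ_v` -/

/-- For the canonical datum, the inner correction `δ_v` IS the quotient `τ⁻¹ τ_v` of the two lifts of `σ`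
(tree `IsLiftOfAut.divGal`), definitionally. [cite: SerreGaloisCohomology1997, II.§1.1] -/
theorem ofLifts_δ_eq_divGal (v : HeightOneSpectrum (𝓞 K)) :
    (ofLifts σ hσ₁ hσ τ hτ hτ₂).δ v = (isLiftOfAut_tauAt hσ v).divGal hτ := rfl

/-- `τ_v x = τ (δ_v x)` for the adapted lift `τ_v` (`tauAt`) and the inner correction `δ_v` of `ofLifts`.
[cite: SerreGaloisCohomology1997, II.§1.1] -/
theorem tauAt_apply_eq (v : HeightOneSpectrum (𝓞 K)) (x : AlgebraicClosure K) :
    tauAt hσ v x = τ ((ofLifts σ hσ₁ hσ τ hτ hτ₂).δ v • x) := by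
  change tauAt hσ v x = τ (τ.symm (tauAt hσ v x))
  rw [RingEquiv.apply_symm_apply]

/-- `τ_v⁻¹ g τ_v = δ_v⁻¹ (τ⁻¹ g τ) δ_v` on `Γ_K`. [cite: SerreGaloisCohomology1997, I.§2.4 (compatible pairs)] -/
theorem conjGalCMH_tauAt (v : HeightOneSpectrum (𝓞 K)) (g : absoluteGaloisGroup K) :
    (isLiftOfAut_tauAt hσ v).conjGalCMH g =
      ((ofLifts σ hσ₁ hσ τ hτ hτ₂).δ v)⁻¹ * ((ofLifts σ hσ₁ hσ τ hτ hτ₂).conj g * (ofLifts σ hσ₁ hσ τ hτ hτ₂).δ v) := by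
  rw [(isLiftOfAut_tauAt hσ v).conjGalCMH_eq_conj_comp hτ, ContinuousMonoidHom.comp_toFun, conjCMH_apply,
    mul_assoc]
  rfl

/-- **`τ_v` on `μ_N` is `ζ ↦ τ(δ_v ζ)`**, hence `= −δ_v·ζ` when `τ` inverts the roots of unity (`τ` a complex
conjugation): `muSemilinearMap τ_v N = −μ_N(δ_v)`. [cite: Howard2004HeegnerKolyvagin, §1.3 H.4 (arXiv p. 7 L69–73: `R(1)`, `τ` acting through the cyclotomic character)] [cite: MilneADT2006, Ch. I §0] -/
theorem muSemilinearMap_tauAt (N : ℕ) (hτμ : ∀ ζ : MuCarrier K N, muSemilinearMap τ N ζ = -ζ)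
    (v : HeightOneSpectrum (𝓞 K)) (ζ : MuCarrier K N) :
    muSemilinearMap (tauAt hσ v) N ζ = -mu K N ((ofLifts σ hσ₁ hσ τ hτ hτ₂).δ v) ζ := by
  rw [← hτμ]
  apply MuCarrier.eq_of_coe_eq
  rw [coe_muSemilinearMap, coe_muSemilinearMap, coe_mu_apply]
  exact tauAt_apply_eq (hσ₁ := hσ₁) (hτ := hτ) (hτ₂ := hτ₂) v _

end ConjugationDatum

namespace ResidualTau

/-! ## §2 `Θ_v := θ ∘ ρ̄(δ_v)` is `τ_v`-semilinear, and `θ_* ∘ transport_v = semilinearLocalH(Θ_v)` -/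

omit [TopologicalSpace R] [DiscreteTopology R] in
/-- **`Θ_v := θ ∘ ρ̄(δ_v)` is `τ_v`-semilinear on `T̄`**: `Θ_v (ρ̄(τ_v⁻¹ g τ_v) m) = ρ̄(g) (Θ_v m)`
(`τ_v⁻¹ g τ_v = δ_v⁻¹ (τ⁻¹ g τ) δ_v` and H.5(a) `θ ∘ ρ̄(τ⁻¹ g τ) = ρ̄(g) ∘ θ`).
[cite: Howard2004HeegnerKolyvagin, §1.3 H.5(a) (arXiv p. 7 L93–95)] [cite: SerreGaloisCohomology1997, I.§2.4] -/
theorem isSemilinear_theta_delta (A : ResidualTau (R := R) (ConjugationDatum.ofLifts σ hσ₁ hσ τ hτ hτ₂) ρbar)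
    (v : HeightOneSpectrum (𝓞 K)) :
    IsSemilinear ρbar (ConjugationDatum.isLiftOfAut_tauAt hσ v)
      (A.θ.toAddMonoidHom.comp (ρbar ((ConjugationDatum.ofLifts σ hσ₁ hσ τ hτ hτ₂).δ v)).toAddMonoidHom) := by
  intro g m
  change A.θ (ρbar ((ConjugationDatum.ofLifts σ hσ₁ hσ τ hτ hτ₂).δ v)
      (ρbar ((ConjugationDatum.isLiftOfAut_tauAt hσ v).conjGalCMH g) m)) =
    ρbar g (A.θ (ρbar ((ConjugationDatum.ofLifts σ hσ₁ hσ τ hτ hτ₂).δ v) m))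
  rw [ConjugationDatum.conjGalCMH_tauAt (hσ₁ := hσ₁) (hτ := hτ) (hτ₂ := hτ₂) v g,
    ← Module.End.mul_apply (ρbar _) (ρbar _), ← map_mul, mul_inv_cancel_left, map_mul,
    Module.End.mul_apply]
  exact A.compat g _

omit [TopologicalSpace R] [DiscreteTopology R] in
/-- **`θ_* ∘ transport_v = σ_*` for the canonical datum**: Howard's `H¹(K_{σv}, T̄) → H¹(K_v, Tw T̄) → H¹(K_v, T̄)`
(transport along `(φ_v, δ_v·)`, then `θ`) IS the tree's semilinear local action `semilinearLocalH` along the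
adapted pair `(Θ_v⁻¹ · Θ_v, θ ∘ ρ̄(δ_v))` — both are `ContinuousCohomology.map` along `φ_v = Θ_v⁻¹ · Θ_v` with
the composite coefficient map. [cite: Howard2004HeegnerKolyvagin, §1.3 and Rem. 1.3.2 (arXiv p. 7 L44–48; p. 8 L13–17: «the composition … is the usual action of complex conjugation»)] [cite: SerreGaloisCohomology1997, I.§2.4] -/
theorem thetaH1_transportH1_ofLifts_eq_semilinearLocalH
    (A : ResidualTau (R := R) (ConjugationDatum.ofLifts σ hσ₁ hσ τ hτ hτ₂) ρbar) (v : HeightOneSpectrum (𝓞 K))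
    (x : galoisCohomology (ρbar.toLocal (Sum.inr ((ConjugationDatum.ofLifts σ hσ₁ hσ τ hτ hτ₂).σ • v))) 1) :
    A.thetaH1 (Sum.inr v) ((ConjugationDatum.ofLifts σ hσ₁ hσ τ hτ hτ₂).transportH1 ρbar v x) =
      semilinearLocalH (E := (σ • v).adicCompletion K) (E' := v.adicCompletion K)
        (ConjugationDatum.isLiftOfAut_tauAt hσ v) (ConjugationDatum.isLift_theta hσ v) (ConjugationDatum.liftsCommute_tauAt hσ v)
        (A.θ.toAddMonoidHom.comp (ρbar ((ConjugationDatum.ofLifts σ hσ₁ hσ τ hτ hτ₂).δ v)).toAddMonoidHom)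
        (A.isSemilinear_theta_delta v) 1 x := by
  obtain ⟨f, rfl⟩ := oneCocycleClass_surjective _ x
  rw [ConjugationDatum.transportH1_oneCocycleClass]
  -- `θ_* [g] = [θ ∘ g]`
  have hθ : ∀ g : contOneCocycles
      ((((ConjugationDatum.ofLifts σ hσ₁ hσ τ hτ hτ₂).twist ρbar).toLocal (Sum.inr v)).toTopRep),
      A.thetaH1 (Sum.inr v) (oneCocycleClass _ g) = oneCocycleClass _
        (contOneCocycles.pullback (ContinuousMonoidHom.id _)
          (X := (((ConjugationDatum.ofLifts σ hσ₁ hσ τ hτ hτ₂).twist ρbar).toLocal (Sum.inr v)).toTopRep)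
          (Y := (ρbar.toLocal (Sum.inr v)).toTopRep)
          (TopRep.ofHom ⟨⟨A.θ.toAddMonoidHom.toIntLinearMap, continuous_of_discreteTopology⟩,
            fun g => ContinuousLinearMap.ext fun x =>
              A.compat (absGaloisRestrict K (Place.Completion (Sum.inr v : Place K)) g) x⟩) g) :=
    fun g => map_oneCocycleClass _ _ _ g
  refine (hθ _).trans ?_
  -- `σ_* [f] = [Θ_v ∘ f ∘ (Θ⁻¹ · Θ)]`
  have hs : semilinearLocalH (E := (σ • v).adicCompletion K) (E' := v.adicCompletion K)
        (ConjugationDatum.isLiftOfAut_tauAt hσ v) (ConjugationDatum.isLift_theta hσ v)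
        (ConjugationDatum.liftsCommute_tauAt hσ v)
        (A.θ.toAddMonoidHom.comp (ρbar ((ConjugationDatum.ofLifts σ hσ₁ hσ τ hτ hτ₂).δ v)).toAddMonoidHom)
        (A.isSemilinear_theta_delta v) 1 (oneCocycleClass _ f) =
      oneCocycleClass _ (contOneCocycles.pullback (ConjugationDatum.isLift_theta hσ v).conjGalCMH
        (semilinearLocalHom (ConjugationDatum.isLiftOfAut_tauAt hσ v) (ConjugationDatum.isLift_theta hσ v)
          (ConjugationDatum.liftsCommute_tauAt hσ v) _ (A.isSemilinear_theta_delta v)) f) :=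
    map_oneCocycleClass _ _ _ f
  refine Eq.trans ?_ hs.symm
  change oneCocycleClass (ρbar.toLocal (Sum.inr v)).toTopRep _ =
    oneCocycleClass (ρbar.toLocal (Sum.inr v)).toTopRep _
  congr 1

end ResidualTau

namespace DualityDatum

/-! ## §3 The `μ`-valued pairing `(s, t) ↦ exp λ ē(s, θ t)`: equivariance and `τ_v`-compatibility -/

section MuPairing

variable (Dbar : DualityDatum p (ConjugationDatum.ofLifts σ hσ₁ hσ τ hτ hτ₂) ρbar R)
  (A : ResidualTau (R := R) (ConjugationDatum.ofLifts σ hσ₁ hσ τ hτ hτ₂) ρbar) {k : ℕ}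
  (lam : R →+ ZMod (p ^ k))
  (hlam : ∀ (z : ℤ_[p]) (r : R), lam (algebraMap ℤ_[p] R z * r) = PadicInt.toZModPow k z * lam r)
  (exp : ZMod (p ^ k) →+ MuCarrier K (p ^ k))
  (hexp : ∀ (g : absoluteGaloisGroup K) (x : ZMod (p ^ k)),
    exp (cyclotomicCharacterModPow K p k g * x) = mu K (p ^ k) g (exp x))

/-- Unfolding: `(exp λ ē)(s, θ t) = exp (λ (ē(s, θ t)))`. [cite: Howard2004HeegnerKolyvagin, §1.3 H.4 and §2.1 (arXiv p. 7 L78–82)] -/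
theorem muPairing_compl₂_theta_apply (s t : Nbar) :
    (Dbar.muPairing lam exp).compl₂ A.θ.toAddMonoidHom s t = exp (lam (Dbar.e s (A.θ t))) := rfl

include hlam hexp in
/-- **`(s,t) ↦ exp λ ē(s, θ t)` is `Γ_K`-equivariant `T̄ × T̄ → μ_{p^k}`** (ORIGINAL action on both factors).
[cite: Howard2004HeegnerKolyvagin, §1.3 H.4, Rem. 1.3.2 and §2.1 (arXiv p. 7 L69–82; p. 8 L13–22)] -/
theorem muPairing_compl₂_theta_equivariant (g : absoluteGaloisGroup K) (s t : Nbar) :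
    (Dbar.muPairing lam exp).compl₂ A.θ.toAddMonoidHom (ρbar g s) (ρbar g t) =
      mu K (p ^ k) g ((Dbar.muPairing lam exp).compl₂ A.θ.toAddMonoidHom s t) := by
  have h := Dbar.thetaPairing_equivariant A g s t
  rw [thetaPairing_apply, thetaPairing_apply] at h
  rw [muPairing_compl₂_theta_apply, muPairing_compl₂_theta_apply, h, ← expLam_apply Dbar lam exp,
    expLam_twistOne Dbar lam hlam exp hexp, expLam_apply]

include hlam hexp in
/-- **Compatibility of `exp λ ē(·, θ ·)` with the semilinear pair `(Θ_v, Θ_v; τ_v)`**: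
`exp λ ē(Θ_v s, θ Θ_v t) = τ_v · exp λ ē(s, θ t)` for `Θ_v = θ ∘ ρ̄(δ_v)` — from H.5(c) (`ē(θx, θy) = −ē(x,y)`),
the symmetry and `Γ_K`-invariance of `ē` at `δ_v`, and «`τ` inverts `μ_{p^k}`».
[cite: Howard2004HeegnerKolyvagin, §1.3 H.4/H.5(c) and Prop. 1.4.3's «flippity» (arXiv p. 7 L69 – p. 8 L1; p. 9 L60–62)] -/
theorem muPairing_compl₂_theta_semilinear (hθ : ∀ x y : Nbar, Dbar.e (A.θ x) (A.θ y) = -Dbar.e x y)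
    (hτμ : ∀ ζ : MuCarrier K (p ^ k), muSemilinearMap τ (p ^ k) ζ = -ζ) (v : HeightOneSpectrum (𝓞 K))
    (s t : Nbar) :
    (Dbar.muPairing lam exp).compl₂ A.θ.toAddMonoidHom
        (A.θ.toAddMonoidHom.comp (ρbar ((ConjugationDatum.ofLifts σ hσ₁ hσ τ hτ hτ₂).δ v)).toAddMonoidHom s)
        (A.θ.toAddMonoidHom.comp (ρbar ((ConjugationDatum.ofLifts σ hσ₁ hσ τ hτ hτ₂).δ v)).toAddMonoidHom t) =
      muSemilinearMap (ConjugationDatum.tauAt hσ v) (p ^ k)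
        ((Dbar.muPairing lam exp).compl₂ A.θ.toAddMonoidHom s t) := by
  set δ := (ConjugationDatum.ofLifts σ hσ₁ hσ τ hτ hτ₂).δ v with hδ
  rw [ConjugationDatum.muSemilinearMap_tauAt (hσ₁ := hσ₁) (hτ := hτ) (hτ₂ := hτ₂) (p ^ k) hτμ v,
    muPairing_compl₂_theta_apply,
    muPairing_compl₂_theta_apply]
  change exp (lam (Dbar.e (A.θ (ρbar δ s)) (A.θ (A.θ (ρbar δ t))))) = -mu K (p ^ k) δ (exp (lam (Dbar.e s (A.θ t))))
  -- `ē(θ a, θ θ b) = ē(θ a, b) = ē(b, θ a) = −ē(a, θ b)` with `a = δ s`, `b = δ t`; then equivariance at `δ`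
  have h1 : Dbar.e (A.θ (ρbar δ s)) (A.θ (A.θ (ρbar δ t))) = -Dbar.e (ρbar δ s) (A.θ (ρbar δ t)) := by
    rw [A.involutive, Dbar.symm (A.θ (ρbar δ s)) (ρbar δ t)]
    have h := Dbar.thetaPairing_swap A hθ (ρbar δ s) (ρbar δ t)
    rw [thetaPairing_apply, thetaPairing_apply] at h
    exact h
  have h2 : Dbar.e (ρbar δ s) (A.θ (ρbar δ t)) = Dbar.twistOne δ (Dbar.e s (A.θ t)) := by
    have h := Dbar.thetaPairing_equivariant A δ s t
    rw [thetaPairing_apply, thetaPairing_apply] at h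
    exact h
  rw [h1, h2, map_neg, map_neg, ← expLam_apply Dbar lam exp, expLam_twistOne Dbar lam hlam exp hexp, expLam_apply]

end MuPairing

/-! ## §4 Reading `∪_P` in `μ_{p^k}`, and the `G_ℚ`-compatibility of the local cup product for `ofLifts` -/

section Invariance

variable (Dbar : DualityDatum p (ConjugationDatum.ofLifts σ hσ₁ hσ τ hτ hτ₂) ρbar R)
  (A : ResidualTau (R := R) (ConjugationDatum.ofLifts σ hσ₁ hσ τ hτ hτ₂) ρbar) {k : ℕ}
  (lam : R →+ ZMod (p ^ k))
  (hlam : ∀ (z : ℤ_[p]) (r : R), lam (algebraMap ℤ_[p] R z * r) = PadicInt.toZModPow k z * lam r)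
  (exp : ZMod (p ^ k) →+ MuCarrier K (p ^ k))
  (hexp : ∀ (g : absoluteGaloisGroup K) (x : ZMod (p ^ k)),
    exp (cyclotomicCharacterModPow K p k g * x) = mu K (p ^ k) g (exp x))

/-- **Reading `∪_P` through `exp ∘ λ`**: at a finite place `w`,
`H²(exp∘λ)(a ∪_P b) = a ∪_{exp λ P} b` in `H²(K_w, μ_{p^k})` (naturality of the cup product in the value module).
[cite: Howard2004HeegnerKolyvagin, §1.3 H.4 and §2.1 (arXiv p. 7 L78–82)] [cite: NeukirchSchmidtWingberg2008, I §4 (1.4.2)] -/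
theorem cohomologyMap_expLam_cupProduct_thetaPairing (w : HeightOneSpectrum (𝓞 K))
    (a b : galoisCohomology (ρbar.toLocal (Sum.inr w)) 1) :
    haveI : CompactSpace (absoluteGaloisGroup (Place.Completion (Sum.inr w : Place K))) :=
      absoluteGaloisGroup_compactSpace _
    cohomologyMap (Dbar.expLamLocalHom lam hlam exp hexp (Sum.inr w)) 2
        ((DiscreteGaloisModule.pairing (ρbar.toLocal (Sum.inr w)) (ρbar.toLocal (Sum.inr w))
            ((Dbar.twistOne).toLocal (Sum.inr w)) (Dbar.eHom.compl₂ A.θ.toAddMonoidHom)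
            (Dbar.thetaPairing_equivariant_toLocal A (Sum.inr w))).cupProduct a b) =
      (DiscreteGaloisModule.pairing (ρbar.toLocal (Sum.inr w)) (ρbar.toLocal (Sum.inr w))
          ((mu K (p ^ k)).toLocal (Sum.inr w)) ((Dbar.muPairing lam exp).compl₂ A.θ.toAddMonoidHom)
          (fun _ s t => Dbar.muPairing_compl₂_theta_equivariant A lam hlam exp hexp _ s t)).cupProduct a b := by
  haveI : CompactSpace (absoluteGaloisGroup (Place.Completion (Sum.inr w : Place K))) :=
    absoluteGaloisGroup_compactSpace _
  have h1 := ContPairing.cupProduct_map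
    (DiscreteGaloisModule.pairing (ρbar.toLocal (Sum.inr w)) (ρbar.toLocal (Sum.inr w))
      ((Dbar.twistOne).toLocal (Sum.inr w)) (Dbar.eHom.compl₂ A.θ.toAddMonoidHom)
      (Dbar.thetaPairing_equivariant_toLocal A (Sum.inr w)))
    (DiscreteGaloisModule.pairing (ρbar.toLocal (Sum.inr w)) (ρbar.toLocal (Sum.inr w))
      ((mu K (p ^ k)).toLocal (Sum.inr w)) ((Dbar.muPairing lam exp).compl₂ A.θ.toAddMonoidHom)
      (fun _ s t => Dbar.muPairing_compl₂_theta_equivariant A lam hlam exp hexp _ s t))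
    (𝟙 _) (𝟙 _) (Dbar.expLamLocalHom lam hlam exp hexp (Sum.inr w)) (fun _ _ => rfl) a b
  have ha : cohomologyMap (𝟙 (ρbar.toLocal (Sum.inr w)).toTopRep) 1 a = a := by
    rw [show cohomologyMap (𝟙 (ρbar.toLocal (Sum.inr w)).toTopRep) 1 = 𝟙 _ from
      ContinuousCohomology.map_id _ _]; rfl
  have hb : cohomologyMap (𝟙 (ρbar.toLocal (Sum.inr w)).toTopRep) 1 b = b := by
    rw [show cohomologyMap (𝟙 (ρbar.toLocal (Sum.inr w)).toTopRep) 1 = 𝟙 _ from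
      ContinuousCohomology.map_id _ _]; rfl
  rw [ha, hb] at h1
  exact h1

omit [Fact p.Prime] in
/-- **The H²-transport for `ofLifts` is the tree's `σ_*` on `H²(K_·, μ_{p^k})`**: the semilinear local action
along the adapted pair of `ofLifts` at `v` with `ζ ↦ τ_v ζ` on `μ_{p^k}` IS `muConjPlace σ (p^k) (σ•(σ•v) = v) 2`
(definitionally). [cite: CasselsFrohlichANT1967, Ch. VI §1.1 and Ch. VII §1.1] -/
theorem muConjPlace_eq_semilinearLocalH_tauAt (v : HeightOneSpectrum (𝓞 K)) (hv : σ • (σ • v) = v) :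
    muConjPlace σ (p ^ k) hv 2 =
      semilinearLocalH (ρ := mu K (p ^ k)) (E := (σ • v).adicCompletion K) (E' := v.adicCompletion K)
        (ConjugationDatum.isLiftOfAut_tauAt hσ v) (ConjugationDatum.isLift_theta hσ v)
        (ConjugationDatum.liftsCommute_tauAt hσ v) (muSemilinearMap (ConjugationDatum.tauAt hσ v) (p ^ k))
        (isSemilinear_mu (ConjugationDatum.isLiftOfAut_tauAt hσ v) (p ^ k)) 2 := rfl

include hlam hexp in
/-- **`G_ℚ`-compatibility of the residual local cup product for the canonical conjugation datum** (the hypothesis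
`hGQ` of `InertLocalPairingInvarianceProofs`, at EVERY finite place `v`): for `x, y ∈ H¹(K_{σ v}, T̄)` and
`τ_v := θ_* ∘ transport_v : H¹(K_{σ v}, T̄) → H¹(K_v, T̄)`,
`inv_v (H²(exp λ)(τ_v x ∪_P τ_v y)) = inv_{σ v} (H²(exp λ)(x ∪_P y))`.
PROOF: `τ_v = σ_*` (`thetaH1_transportH1_ofLifts_eq_semilinearLocalH`), `σ_*(a ∪ b) = σ_* a ∪ σ_* b` for the
`μ`-valued pairing `exp λ ē(·, θ ·)` (`semilinearLocalH_cupProduct` with `muPairing_compl₂_theta_semilinear`), the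
`H²`-transport on `μ_{p^k}` is `muConjPlace σ (p^k) _ 2`, and `inv_v ∘ σ_* = inv_{σ v}` (`LocalInvariants.IsConjCompatible`,
the functoriality of THE invariant maps under isomorphisms of local fields — a kernel theorem for the canonical
family, `isConjCompatible_canonical`). Inputs kept as letters: H.5(c) in the form `hθ`, «`τ` inverts `μ_{p^k}`»
(`hτμ`, true for a complex conjugation), the reading `(λ, exp)`.
[cite: Howard2004HeegnerKolyvagin, Lemma 1.5.3 (arXiv p. 10 L10–12: «the `G_ℚ`-invariant local Tate pairing»)]
[cite: CasselsFrohlichANT1967, Ch. VI §1.1 (functoriality of `inv`)] [cite: NeukirchSchmidtWingberg2008, I §5] -/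
theorem inv_cohomologyMap_cupProduct_thetaH1_transportH1_ofLifts [Finite Nbar]
    (hθ : ∀ x y : Nbar, Dbar.e (A.θ x) (A.θ y) = -Dbar.e x y)
    (hτμ : ∀ ζ : MuCarrier K (p ^ k), muSemilinearMap τ (p ^ k) ζ = -ζ)
    (inv : LocalInvariants K (p ^ k)) (hinv : inv.IsConjCompatible σ)
    (v : HeightOneSpectrum (𝓞 K)) (hv : σ • (σ • v) = v)
    (x y : galoisCohomology (ρbar.toLocal (Sum.inr ((ConjugationDatum.ofLifts σ hσ₁ hσ τ hτ hτ₂).σ • v))) 1) :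
    inv (Sum.inr v) (cohomologyMap (Dbar.expLamLocalHom lam hlam exp hexp (Sum.inr v)) 2
      (haveI : CompactSpace (absoluteGaloisGroup (Place.Completion (Sum.inr v : Place K))) :=
          absoluteGaloisGroup_compactSpace _;
        (DiscreteGaloisModule.pairing (ρbar.toLocal (Sum.inr v)) (ρbar.toLocal (Sum.inr v))
            (Dbar.twistOne.toLocal (Sum.inr v)) (Dbar.eHom.compl₂ A.θ.toAddMonoidHom)
            (Dbar.thetaPairing_equivariant_toLocal A (Sum.inr v))).cupProduct
          (A.thetaH1 (Sum.inr v) ((ConjugationDatum.ofLifts σ hσ₁ hσ τ hτ hτ₂).transportH1 ρbar v x))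
          (A.thetaH1 (Sum.inr v) ((ConjugationDatum.ofLifts σ hσ₁ hσ τ hτ hτ₂).transportH1 ρbar v y)))) =
    inv (Sum.inr ((ConjugationDatum.ofLifts σ hσ₁ hσ τ hτ hτ₂).σ • v))
      (cohomologyMap (Dbar.expLamLocalHom lam hlam exp hexp
          (Sum.inr ((ConjugationDatum.ofLifts σ hσ₁ hσ τ hτ hτ₂).σ • v))) 2
        (haveI : CompactSpace (absoluteGaloisGroup (Place.Completion
            (Sum.inr ((ConjugationDatum.ofLifts σ hσ₁ hσ τ hτ hτ₂).σ • v) : Place K))) :=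
          absoluteGaloisGroup_compactSpace _;
        (DiscreteGaloisModule.pairing (ρbar.toLocal (Sum.inr ((ConjugationDatum.ofLifts σ hσ₁ hσ τ hτ hτ₂).σ • v)))
            (ρbar.toLocal (Sum.inr ((ConjugationDatum.ofLifts σ hσ₁ hσ τ hτ hτ₂).σ • v)))
            (Dbar.twistOne.toLocal (Sum.inr ((ConjugationDatum.ofLifts σ hσ₁ hσ τ hτ hτ₂).σ • v)))
            (Dbar.eHom.compl₂ A.θ.toAddMonoidHom)
            (Dbar.thetaPairing_equivariant_toLocal A
              (Sum.inr ((ConjugationDatum.ofLifts σ hσ₁ hσ τ hτ hτ₂).σ • v)))).cupProduct x y)) := by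
  haveI : CompactSpace (absoluteGaloisGroup (Place.Completion (Sum.inr v : Place K))) :=
    absoluteGaloisGroup_compactSpace _
  haveI : CompactSpace (absoluteGaloisGroup (Place.Completion
      (Sum.inr ((ConjugationDatum.ofLifts σ hσ₁ hσ τ hτ hτ₂).σ • v) : Place K))) :=
    absoluteGaloisGroup_compactSpace _
  haveI : CompactSpace (absoluteGaloisGroup ((σ • v).adicCompletion K)) := absoluteGaloisGroup_compactSpace _
  haveI : CompactSpace (absoluteGaloisGroup (v.adicCompletion K)) := absoluteGaloisGroup_compactSpace _
  rw [A.thetaH1_transportH1_ofLifts_eq_semilinearLocalH v x, A.thetaH1_transportH1_ofLifts_eq_semilinearLocalH v y,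
    Dbar.cohomologyMap_expLam_cupProduct_thetaPairing A lam hlam exp hexp v,
    Dbar.cohomologyMap_expLam_cupProduct_thetaPairing A lam hlam exp hexp
      ((ConjugationDatum.ofLifts σ hσ₁ hσ τ hτ hτ₂).σ • v)]
  -- `σ_*(x ∪ y) = σ_* x ∪ σ_* y` for the `μ`-valued pairing
  have hcup := semilinearLocalH_cupProduct (E := (σ • v).adicCompletion K) (E' := v.adicCompletion K)
    (ρ := ρbar) (ρN := ρbar) (ρP := mu K (p ^ k))
    (ConjugationDatum.isLiftOfAut_tauAt hσ v) (ConjugationDatum.isLift_theta hσ v)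
    (ConjugationDatum.liftsCommute_tauAt hσ v) ((Dbar.muPairing lam exp).compl₂ A.θ.toAddMonoidHom)
    (Dbar.muPairing_compl₂_theta_equivariant A lam hlam exp hexp)
    _ (A.isSemilinear_theta_delta v) _ (A.isSemilinear_theta_delta v)
    (muSemilinearMap (ConjugationDatum.tauAt hσ v) (p ^ k))
    (isSemilinear_mu (ConjugationDatum.isLiftOfAut_tauAt hσ v) (p ^ k))
    (Dbar.muPairing_compl₂_theta_semilinear A lam hlam exp hexp hθ hτμ v) x y
  refine (congrArg (inv (Sum.inr v)) hcup.symm).trans ?_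
  -- the `H²`-transport is `muConjPlace`, and `inv_v ∘ σ_* = inv_{σ v}`
  exact hinv (σ • v) v hv _

end Invariance

end DualityDatum

end Literature.NumberTheory.GaloisCohomology.Howard2004
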